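/-
Copyright (c) 2026. All rights reserved.
Released under Apache 2.0 license as described in the file LICENSE.
Authors: HodgeCM publication cell (pub-hodgecm), GR lane, seat GR-1 (`pub-hodgecm-own-real34`).
-/
import Literature.NumberTheory.GelbartRogawski1991.DoubledWeilRepresentationArchDeltaSign
import Literature.NumberTheory.GelbartRogawski1991.DoubledWeilRepresentationArchLiftSigns
import Literature.NumberTheory.GelbartRogawski1991.DoubledUnitaryArchSiegelDiagonalModulusReal
import Literature.NumberTheory.GelbartRogawski1991.DoubledUnitaryArchSiegelRealSign
import Literature.NumberTheory.GelbartRogawski1991.DoubledWeilRepresentationArchTwistRealValues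
import Literature.NumberTheory.GelbartRogawski1991.DoubledUnitaryArchSiegelSignRepsGen
import Literature.NumberTheory.GelbartRogawski1991.DoubledUnitaryArchSiegelSignRepsValues
import HarnessLib

/-!
# The archimedean half over a general quadratic `E/F` (real places of `E` allowed), diagonal Gram data

Topic `NumberTheory/GelbartRogawski1991`; namespace `Literature.NumberTheory.GelbartRogawski1991.GRConstructionGen`.  KERNEL
only: proved theorems; no definition, no named fact, no `sorry`.  THE TYPE-(ii) ASSEMBLY of the archimedean half of
[GelbartRogawski1991, §3.1 Prop. 3.1.1] for a quadratic extension `E/F` of number fields in which `E` may have REAL places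
(type-(ii) real places `v` of `F`: both places of `E` over `v` real).  For the doubled unitary group `H = U(J^𝔻)` at diagonal
Gram data `T_V = diag dV`, `T_W = diag dW` (`n = NM > 0`), a unitary Hecke character `χ` of `E` with `χ|_{𝕀_F} = ε_{E/F}`, and the
three-block archimedean section `s_∞ = archWeilHalf3D x₂ hx₂ x₃ hx₃` of `DoubledWeilRepresentationArchHalf3`, we prove

* **`exists_isArchHalf_twist_archWeilHalf3D_real`**: given an enumeration `eκ : κ₂ ⊕ κ₂ ≃ {w real}` of the real places of `E`
  by the type-(ii) places (`inl k ↦ w₂(k) = placeAboveTwo k`, `inr k ↦ c⁻¹ w₂(k)`), there is a continuous-valued character `η` of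
  `H(F ⊗ ℝ)` with `IsArchHalf χ (s_∞ ⊗ η)`; and
* **`exists_isArchHalf_real`**: hence `∃ sa, IsArchHalf χ sa` at such data.

The proof feeds `DoubledWeilRepresentationArchLiftSigns.exists_isArchHalf_twist_prod_signs` (the sign-twisted parabolic
prescription: `η = η₀ · ∏_{(ii)} s_v^{e_v}`) with: the telescope `jA := archToAdelic`, `eW := frame3D`, `sW := archWeilSection3D`,
`sa := archWeilHalf3D` (`archWeilHalf3D_eq_archLift`, seat GR-2); the signed action on `Δ`
(`DoubledUnitaryArchSiegelDiagonalModulusReal`); the squares identity `η₀² · quot · sgn = χ(det_Δ)²` from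
`DoubledWeilRepresentationArchTwistReal.exists_archDetTwist_chiDet_real`, `quot_archWeilSection3D` (GR-2) and
`DoubledUnitaryArchSiegelRealSign`; the sign characters `s_v = detSignAtR (w₂ v)` (`QuadExtArchRealDetSign`); the sign
representatives, their `P_Δ`-membership, sign values and generation (`DoubledUnitaryArchSiegelSignRepsGen`, `ε = diag(-1,1,…,1)`);
and the origin value `+1` at the pair representatives (`conj_archWeilSection3D_apply_zero_of_sign`, GR-2, with the coordinates
of `DoubledUnitaryArchSiegelSignRepsDiagonal`), turned into the `hval₀` binder by
`DoubledWeilRepresentationArchLiftReps.hval_of_originValue_one`, `DoubledWeilRepresentationArchTwistRealValues.archTwist_pair_eq_one`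
and `DoubledUnitaryArchSiegelSignRepsValues` (`χ(det_Δ q₀) = 1`, `|det_Δ q₀| = 1`).
([GelbartRogawski1991, §3.1 Prop. 3.1.1 p. 455]; [Kudla1994, §3]; [HarrisKudlaSweet1996, §1].)  Written for the stage-1 cell
`pub-hodgecm` (seat GR-1); nothing here is a claim of the manuscripts adjudicated by that cell; in particular this file does
NOT inhabit `Prop311AsPrinted` and HC_CM is NOT proved here.

## References

* S. Gelbart, J. Rogawski, Invent. Math. 105 (1991), §3.1 Prop. 3.1.1 p. 455 [GelbartRogawski1991].
* S. S. Kudla, Israel J. Math. 87 (1994), §3 [Kudla1994].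
* M. Harris, S. Kudla, W. J. Sweet, J. Amer. Math. Soc. 9 (1996), §1 [HarrisKudlaSweet1996].
-/

set_option autoImplicit false

noncomputable section

open scoped Classical ComplexConjugate MatrixGroups
open scoped Matrix
open NumberField NumberField.InfinitePlace NumberField.mixedEmbedding IsDedekindDomain
open Literature.NumberTheory.Automorphic Literature.NumberTheory.Automorphic.UnitaryGroup
open Literature.NumberTheory.Weil1964
open Literature.NumberTheory.GaloisRepresentations
open Literature.RepresentationTheory.HeisenbergGroup
open Literature.RepresentationTheory.HarrisKudlaSweet1996
open Literature.NumberTheory.GelbartRogawski1991.UnitaryDualPair.ArchSplitting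
open Literature.NumberTheory.GelbartRogawski1991.UnitaryDualPair.ArchSplitting.QuadExt

namespace Literature.NumberTheory.GelbartRogawski1991.GRConstructionGen

open UnitaryDualPair

/-! ## §1 Two elementary identities -/

/-- `(if 0 < d then 1 else -1) · sgn d = 1` for `d ≠ 0` (in `ℂ`). [folklore] -/
private theorem ite_mul_sign_eq_one (d : ℝ) (hd : d ≠ 0) :
    (if 0 < d then (1 : ℂ) else -1) * ((Real.sign d : ℝ) : ℂ) = 1 := by
  rcases lt_or_gt_of_ne hd with h | h
  · rw [if_neg (not_lt.mpr h.le), Real.sign_of_neg h]; push_cast; ring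
  · rw [if_pos h, Real.sign_of_pos h]; push_cast; ring

/-- `|det ((mulSingle a ε · mulSingle b ε) w)| = 1` when `|det ε| = 1`. [folklore] -/
private theorem abs_det_mulSingle_mul_mulSingle_apply {ι : Type*} [DecidableEq ι] {m : Type*} [Fintype m] [DecidableEq m]
    (a b : ι) (ε : GL m ℝ) (hε : |((ε : GL m ℝ) : Matrix m m ℝ).det| = 1) (w : ι) :
    |(((Pi.mulSingle a ε * Pi.mulSingle b ε : ι → GL m ℝ) w : GL m ℝ) : Matrix m m ℝ).det| = 1 := by
  have h1 : ∀ x : ι, |(((Pi.mulSingle x ε : ι → GL m ℝ) w : GL m ℝ) : Matrix m m ℝ).det| = 1 := by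
    intro x
    by_cases h : w = x
    · subst h; rw [Pi.mulSingle_eq_same]; exact hε
    · rw [Pi.mulSingle_eq_of_ne h]; simp
  rw [Pi.mul_apply, Units.val_mul, Matrix.det_mul, abs_mul, h1, h1, mul_one]

variable (F : Type) [Field F] [NumberField F] (E : Type) [Field E] [NumberField E] [Algebra F E]
  [Algebra.IsQuadraticExtension F E]
variable (c : E ≃ₐ[F] E) {δ : E} (hcδ : c δ = -δ) (hδ : δ ≠ 0) {d : F} (hd : δ * δ = algebraMap F E d)
variable {N M n : ℕ} (e : Fin N × Fin M ≃ Fin n)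
  (dV : Fin N → F) (hV : (Matrix.diagonal dV).IsSymm) (hVd : IsUnit (Matrix.diagonal dV).det) (hdV0 : ∀ i, dV i ≠ 0)
  (dW : Fin M → F) (hW : (Matrix.diagonal dW).IsSymm) (hWd : IsUnit (Matrix.diagonal dW).det) (hdW0 : ∀ j, dW j ≠ 0)
variable (x₂ : MpS (Fin (n + n) × {v : {v : InfinitePlace F // v.IsReal} // ¬ IsTypeOne F E v}))
  (hx₂ : MpS.proj x₂ = placeSp fun k => (rsCayley3D F E e dV hdV0 dW hdW0 (hδ := hδ) k)⁻¹)
  (x₃ : MpS ((Fin (n + n) ⊕ Fin (n + n)) × {v : InfinitePlace F // v.IsComplex}))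
  (hx₃ : MpS.proj x₃ = placeSp fun v => (cxKappa3D F E e dV hdV0 dW hdW0 (hδ := hδ) v)⁻¹)

/-! ## §2 The archimedean half at diagonal data, real places allowed -/

set_option maxHeartbeats 6400000 in
include hV hW in
/-- **THE ARCHIMEDEAN HALF OVER A GENERAL QUADRATIC `E/F` (TYPE (ii) INCLUDED).**  At diagonal Gram data, for a
unitary Hecke character `χ` of `E` with `χ|_{𝕀_F} = ε_{E/F}` and an enumeration `eκ : κ₂ ⊕ κ₂ ≃ {w real}` of the real places
of `E` over the type-(ii) places (`inl k ↦ w₂(k)`, `inr k ↦ c⁻¹ w₂(k)`), there is a character `η` of `H(F ⊗ ℝ)` with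
`IsArchHalf χ (s_∞ ⊗ η)`, `s_∞ = archWeilHalf3D x₂ hx₂ x₃ hx₃`: `η = η₁ · η_(ii) · η_ℂ · ∏_{(ii)} s_v^{e_v}` with `e_v ∈ {0, 1}`
the signs pinned by the parabolic prescription at the single sign representatives (`n > 0`; for `n = 0` the group is trivial
and `η = η₀`).
[cite: GelbartRogawski1991, §3.1 Prop. 3.1.1 p. 455] [cite: Kudla1994, §3] [cite: HarrisKudlaSweet1996, §1 (1.15)] -/
theorem exists_isArchHalf_twist_archWeilHalf3D_real {χ : HeckeCharacter E} (hχu : χ.IsUnitary)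
    (hχ : IsSplittingCharExt F E 1 χ)
    (eκ : {v : {v : InfinitePlace F // v.IsReal} // ¬ IsTypeOne F E v} ⊕
        {v : {v : InfinitePlace F // v.IsReal} // ¬ IsTypeOne F E v} ≃ {w : InfinitePlace E // w.IsReal})
    (he₁ : ∀ k, eκ (Sum.inl k) = placeAboveTwo F E k)
    (he₂ : ∀ k, eκ (Sum.inr k) =
      ⟨c⁻¹ • (placeAboveTwo F E k).1, isReal_smul_iff.mpr (placeAboveTwo F E k).2⟩) :
    ∃ η : arch F E c (n + n) (hermD F E e (Matrix.diagonal dV) (Matrix.diagonal dW)) →* ℂˣ,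
      IsArchHalf F E c hcδ hδ hd e (Matrix.diagonal dV) hV hVd (Matrix.diagonal dW) hW hWd χ
        (adelicMpCont.twist F (Fin (n + n)) (gramDA F e (Matrix.diagonal dV) (Matrix.diagonal dW))
          (archWeilHalf3D F E c hcδ hδ hd e dV hVd hdV0 dW hWd hdW0 x₂ hx₂ x₃ hx₃) η) := by
  have hc : c ≠ 1 := LocalSplitting.galConj_ne_one_of_delta F E c hcδ hδ
  have hc' : ∀ x, c (c x) = x := LocalSplitting.galConj_apply_apply F E c hcδ hδ
  have hcc : c * c = 1 := AlgEquiv.ext hc'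
  have hTd := gramD_eq_diagonal_gen F e dV dW
  have ht0 := t₀D_ne_zero F e dV hdV0 dW hdW0
  -- (A) the character `η₀ = η₁ · η_(ii) · η_ℂ` and its squares identity
  have hover₁ : ∀ k : {v : {v : InfinitePlace F // v.IsReal} // IsTypeOne F E v},
      (placeAboveOne F E k).1.comap (algebraMap F E) = ((Equiv.sumCompl (IsTypeOne F E)) (Sum.inl k)).1 := fun k => by
    rw [Equiv.sumCompl_apply_inl]; exact placeAboveOne_comap F E k
  have hover₂ : ∀ k : {v : {v : InfinitePlace F // v.IsReal} // ¬ IsTypeOne F E v},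
      (placeAboveTwo F E k).1.comap (algebraMap F E) = ((Equiv.sumCompl (IsTypeOne F E)) (Sum.inr k)).1 := fun k => by
    rw [Equiv.sumCompl_apply_inr]; exact placeAboveTwo_comap F E k
  obtain ⟨ex, η₁, -, hη₁, hη₀c, hη₀S⟩ := exists_archDetTwist_chiDet_real F E c hcδ hδ e (Matrix.diagonal dV) hVd
    (Matrix.diagonal dW) hWd hχu hχ (placeAboveOne F E) (smul_placeAboveOne F E c) (placeAboveTwo F E)
    (placeAboveComplex F E) (placeAboveComplex_comap F E) (Equiv.sumCompl (IsTypeOne F E)) hover₁ hover₂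
  set η₀ : arch F E c (n + n) (hermD F E e (Matrix.diagonal dV) (Matrix.diagonal dW)) →* ℂˣ :=
    η₁ * archTwistR F E c e (Matrix.diagonal dV) (Matrix.diagonal dW) (placeAboveTwo F E) χ *
      archTwistC F E c e (Matrix.diagonal dV) (Matrix.diagonal dW) χ (placeAboveComplex F E) with hη₀
  -- the section is continuous (GR-2)
  have hcont : Continuous ⇑(archWeilHalf3D F E c hcδ hδ hd e dV hVd hdV0 dW hWd hdW0 x₂ hx₂ x₃ hx₃) :=
    continuous_archWeilHalf3 E c (n + n) hc hcc (IsTypeOne F E) (placeAboveOne F E) (smul_placeAboveOne F E c)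
      (placeAboveOne_comap F E) (placeAboveTwo F E) (placeAboveTwo_comap F E) (placeAboveComplex F E)
      (placeAboveComplex_comap F E) (t₀D F e dV dW) ht0 hTd rfl hcδ hδ hd x₂ hx₂ x₃ hx₃
      (isUnit_archMat_gramDA F e _ hVd _ hWd)
  -- a metaplectic reading `z` of `δ_∞`
  obtain ⟨z, hz⟩ := exists_MpS_over_archPhaseMap (gramDA F e (Matrix.diagonal dV) (Matrix.diagonal dW))
    (frame3D F E c hcδ hδ e dV hdV0 dW hdW0) (isUnit_archMat_gramDA F e _ hVd _ hWd)
    (ratSp F (gramDA F e (Matrix.diagonal dV) (Matrix.diagonal dW)) (isUnit_det_gramDA F e _ hVd _ hWd) (deltaD F))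
  have hz' : (⇑((MpS.proj z).1 : ((FrameIdx F (Fin (n + n)) → ℝ) × (FrameIdx F (Fin (n + n)) → ℝ)) ≃ₗ[ℝ]
        ((FrameIdx F (Fin (n + n)) → ℝ) × (FrameIdx F (Fin (n + n)) → ℝ))) :
        ((FrameIdx F (Fin (n + n)) → ℝ) × (FrameIdx F (Fin (n + n)) → ℝ)) →
          ((FrameIdx F (Fin (n + n)) → ℝ) × (FrameIdx F (Fin (n + n)) → ℝ))) =
      archPhaseMap (gramDA F e (Matrix.diagonal dV) (Matrix.diagonal dW)) (frame3D F E c hcδ hδ e dV hdV0 dW hdW0)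
        (isUnit_archMat_gramDA F e _ hVd _ hWd)
        (adelicMpCont.proj F (Fin (n + n)) (gramDA F e (Matrix.diagonal dV) (Matrix.diagonal dW))
          (rDelta F e (Matrix.diagonal dV) hVd (Matrix.diagonal dW) hWd)) := by
    rw [projD_rDelta F e (Matrix.diagonal dV) hVd (Matrix.diagonal dW) hWd]; exact hz
  -- the squares identity `η₀² · quot · sgn = χ(det_Δ)²`
  have hηS : ∀ g : arch F E c (n + n) (hermD F E e (Matrix.diagonal dV) (Matrix.diagonal dW)),
      IsSiegelDelta F E c e (Matrix.diagonal dV) (Matrix.diagonal dW)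
        (UnitaryGroup.archToAdelic F E c (n + n) (hermD F E e (Matrix.diagonal dV) (Matrix.diagonal dW)) g) →
      ((η₀ g : ℂˣ) : ℂ) ^ 2 * MpS.quot (archWeilSection3D F E c hcδ hδ e dV hdV0 dW hdW0 x₂ x₃ g) *
        ((∏ w : {w : InfinitePlace E // w.IsReal},
          Real.sign ((archMat E (Fin n) (deltaBlock F E c e (Matrix.diagonal dV) (Matrix.diagonal dW)
            (UnitaryGroup.archToAdelic F E c (n + n) (hermD F E e (Matrix.diagonal dV) (Matrix.diagonal dW)) g))).det.1 w) : ℝ) : ℂ) =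
      ((chiDet F E c e (Matrix.diagonal dV) (Matrix.diagonal dW) χ
        (UnitaryGroup.archToAdelic F E c (n + n) (hermD F E e (Matrix.diagonal dV) (Matrix.diagonal dW)) g) : ℂˣ) : ℂ) ^ 2 := by
    intro g hS
    have hBS : (∏ k : {v : {v : InfinitePlace F // v.IsReal} // ¬ IsTypeOne F E v},
        (if 0 < ((((g : GL (Fin (n + n)) (mixedSpace E)) :
            Matrix (Fin (n + n)) (Fin (n + n)) (mixedSpace E))).map (evalR E (placeAboveTwo F E k))).det
          then (1 : ℂ) else -1)) *
        (((∏ k : {v : {v : InfinitePlace F // v.IsReal} // ¬ IsTypeOne F E v},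
          Real.sign ((((g : GL (Fin (n + n)) (mixedSpace E)) : Matrix (Fin (n + n)) (Fin (n + n)) (mixedSpace E))).map
            (evalR E (placeAboveTwo F E k))).det : ℝ) : ℂ)) = 1 := by
      push_cast
      rw [← Finset.prod_mul_distrib]
      exact Finset.prod_eq_one fun k _ => ite_mul_sign_eq_one _ (det_map_evalR_ne_zero F E c _ (placeAboveTwo F E k) g)
    rw [quot_archWeilSection3D, prod_sign_det_deltaBlock_eq_prod_sign_det F E c e (Matrix.diagonal dV) hVd
      (Matrix.diagonal dW) hWd hcc (placeAboveTwo F E) eκ he₁ he₂ g hS]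
    calc _ = ((η₀ g : ℂˣ) : ℂ) ^ 2 *
          (∏ k : {v : {v : InfinitePlace F // v.IsReal} // IsTypeOne F E v},
            ((((archAt F E c (n + n) (hermD F E e (Matrix.diagonal dV) (Matrix.diagonal dW)) (placeAboveOne F E k)
              (smul_placeAboveOne F E c k) (LocalSplitting.galConj_ne_one_of_delta F E c hcδ hδ) g :
              archLocal E (n + n) (hermD F E e (Matrix.diagonal dV) (Matrix.diagonal dW)) (placeAboveOne F E k)) :
              GL (Fin (n + n)) ℂ) : Matrix (Fin (n + n)) (Fin (n + n)) ℂ).det)⁻¹) *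
          ((∏ k : {v : {v : InfinitePlace F // v.IsReal} // ¬ IsTypeOne F E v},
            (if 0 < ((((g : GL (Fin (n + n)) (mixedSpace E)) :
              Matrix (Fin (n + n)) (Fin (n + n)) (mixedSpace E))).map (evalR E (placeAboveTwo F E k))).det
              then (1 : ℂ) else -1)) *
          (((∏ k : {v : {v : InfinitePlace F // v.IsReal} // ¬ IsTypeOne F E v},
            Real.sign ((((g : GL (Fin (n + n)) (mixedSpace E)) : Matrix (Fin (n + n)) (Fin (n + n)) (mixedSpace E))).map
              (evalR E (placeAboveTwo F E k))).det : ℝ) : ℂ))) := by ring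
      _ = ((η₀ g : ℂˣ) : ℂ) ^ 2 *
          (∏ k : {v : {v : InfinitePlace F // v.IsReal} // IsTypeOne F E v},
            ((((archAt F E c (n + n) (hermD F E e (Matrix.diagonal dV) (Matrix.diagonal dW)) (placeAboveOne F E k)
              (smul_placeAboveOne F E c k) (LocalSplitting.galConj_ne_one_of_delta F E c hcδ hδ) g :
              archLocal E (n + n) (hermD F E e (Matrix.diagonal dV) (Matrix.diagonal dW)) (placeAboveOne F E k)) :
              GL (Fin (n + n)) ℂ) : Matrix (Fin (n + n)) (Fin (n + n)) ℂ).det)⁻¹) := by rw [hBS, mul_one]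
      _ = _ := hη₀S g hS
  rcases Nat.eq_zero_or_pos n with hn | hn
  · -- `n = 0`: `H(F ⊗ ℝ)` is trivial; no sign representatives are needed
    have hE : IsEmpty (Fin (n + n)) := ⟨fun i => absurd i.2 (by omega)⟩
    have h1 : ∀ p : arch F E c (n + n) (hermD F E e (Matrix.diagonal dV) (Matrix.diagonal dW)), p = 1 := fun p =>
      Subtype.ext (Units.ext (Subsingleton.elim _ _))
    refine (exists_isArchHalf_twist_prod_signs F E c hcδ hδ hd e (Matrix.diagonal dV) hV hVd
      (Matrix.diagonal dW) hW hWd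
      (UnitaryGroup.archToAdelic F E c (n + n) (hermD F E e (Matrix.diagonal dV) (Matrix.diagonal dW))) rfl
      (frame3D F E c hcδ hδ e dV hdV0 dW hdW0) (archWeilSection3D F E c hcδ hδ e dV hdV0 dW hdW0 x₂ x₃)
      (archWeilHalf3D_hfin F E c hcδ hδ hd e dV hV dW hW)
      (archWeilHalf3D_hdict F E c hcδ hδ hd e dV hV hVd hdV0 dW hW hWd hdW0 x₂ hx₂ x₃ hx₃)
      (archWeilHalf3D F E c hcδ hδ hd e dV hVd hdV0 dW hWd hdW0 x₂ hx₂ x₃ hx₃)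
      (archWeilHalf3D_eq_archLift F E c hcδ hδ hd e dV hV hVd hdV0 dW hW hWd hdW0 x₂ hx₂ x₃ hx₃)
      (fun g => ∏ w : {w : InfinitePlace E // w.IsReal},
        Real.sign ((archMat E (Fin n) (deltaBlock F E c e (Matrix.diagonal dV) (Matrix.diagonal dW)
          (UnitaryGroup.archToAdelic F E c (n + n) (hermD F E e (Matrix.diagonal dV) (Matrix.diagonal dW)) g))).det.1 w))
      (fun g hS => exists_archAct_diagPair_det_eq_sign_mul_modDelta_sq F E c hcδ hδ hd e (Matrix.diagonal dV) hV
        (Matrix.diagonal dW) hW g hS)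
      χ hcont η₀ hη₀c hηS (ι₁ := Empty) (fun i => i.elim) (fun i => i.elim) (fun i => i.elim) ∅
      (fun q hq => by simp at hq) (fun i => i.elim) (fun i => i.elim) (fun i => i.elim) (fun i => i.elim)
      (fun i => i.elim) (fun p _ => ⟨[], [], fun _ h => by simp at h, fun _ h => by simp at h, by simp [h1 p]⟩)
      (fun q hq => by simp at hq)).elim fun exs h => ⟨_, h.2⟩
  -- `n > 0`
  · -- the sign `ε = diag(-1, 1, …, 1)`
    set i₀ : Fin n := ⟨0, hn⟩ with hi₀
    set dε : Fin n → ℝ := Function.update (fun _ => (1 : ℝ)) i₀ (-1) with hdεdef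
    have hdε1 : ∀ i, dε i = 1 ∨ dε i = -1 := by
      intro i
      by_cases hi : i = i₀
      · subst hi; right; simp [dε]
      · left; simp [dε, hi]
    have hdε : ∀ i, dε i * dε i = 1 := fun i => by rcases hdε1 i with h | h <;> simp [h]
    have hdd : Matrix.diagonal dε * Matrix.diagonal dε = 1 := by
      rw [Matrix.diagonal_mul_diagonal, ← Matrix.diagonal_one]
      exact congrArg Matrix.diagonal (funext hdε)
    set ε : GL (Fin n) ℝ := ⟨Matrix.diagonal dε, Matrix.diagonal dε, hdd, hdd⟩ with hεdef
    have hεd : ((ε : GL (Fin n) ℝ) : Matrix (Fin n) (Fin n) ℝ) = Matrix.diagonal dε := rfl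
    have hε : ε * ε = 1 := Units.ext hdd
    have hdetε : ((ε : GL (Fin n) ℝ) : Matrix (Fin n) (Fin n) ℝ).det = -1 := by
      rw [hεd, Matrix.det_diagonal, Finset.prod_update_of_mem (Finset.mem_univ i₀)]
      simp
    have hεdet : ((ε : GL (Fin n) ℝ) : Matrix (Fin n) (Fin n) ℝ).det < 0 := by rw [hdetε]; norm_num
    have hεabs : |((ε : GL (Fin n) ℝ) : Matrix (Fin n) (Fin n) ℝ).det| = 1 := by rw [hdetε]; norm_num
    -- (B4) the sign representatives
    obtain ⟨mA, hP, hΔ, h2, hs₁, hs₁', hs₀, hgen⟩ := exists_signReps_gen (F := F) (E := E) (c := c) (e := e)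
      (TV := Matrix.diagonal dV) (TW := Matrix.diagonal dW) (hV := hV) (hVd := hVd) (hW := hW) (hWd := hWd)
      (wOf := placeAboveTwo F E) (eκ := eκ) (he₁ := he₁) (he₂ := he₂) (hc := hc') (ε := ε) (hεdet := hεdet) (hε := hε)
    -- the assembly
    refine (exists_isArchHalf_twist_prod_signs F E c hcδ hδ hd e (Matrix.diagonal dV) hV hVd
      (Matrix.diagonal dW) hW hWd
      (UnitaryGroup.archToAdelic F E c (n + n) (hermD F E e (Matrix.diagonal dV) (Matrix.diagonal dW))) rfl
      (frame3D F E c hcδ hδ e dV hdV0 dW hdW0) (archWeilSection3D F E c hcδ hδ e dV hdV0 dW hdW0 x₂ x₃)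
      (archWeilHalf3D_hfin F E c hcδ hδ hd e dV hV dW hW)
      (archWeilHalf3D_hdict F E c hcδ hδ hd e dV hV hVd hdV0 dW hW hWd hdW0 x₂ hx₂ x₃ hx₃)
      (archWeilHalf3D F E c hcδ hδ hd e dV hVd hdV0 dW hWd hdW0 x₂ hx₂ x₃ hx₃)
      (archWeilHalf3D_eq_archLift F E c hcδ hδ hd e dV hV hVd hdV0 dW hW hWd hdW0 x₂ hx₂ x₃ hx₃)
      (fun g => ∏ w : {w : InfinitePlace E // w.IsReal},
        Real.sign ((archMat E (Fin n) (deltaBlock F E c e (Matrix.diagonal dV) (Matrix.diagonal dW)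
          (UnitaryGroup.archToAdelic F E c (n + n) (hermD F E e (Matrix.diagonal dV) (Matrix.diagonal dW)) g))).det.1 w))
      (fun g hS => exists_archAct_diagPair_det_eq_sign_mul_modDelta_sq F E c hcδ hδ hd e (Matrix.diagonal dV) hV
        (Matrix.diagonal dW) hW g hS)
      χ hcont η₀ hη₀c hηS (fun k => detSignAtR F E c (hermD F E e (Matrix.diagonal dV) (Matrix.diagonal dW)) (placeAboveTwo F E k))
      (fun k g => detSignAtR_mul_self F E c _ (placeAboveTwo F E k) g)
      (fun k => continuous_detSignAtR F E c _ (placeAboveTwo F E k))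
      (Set.range fun k => mA (signPatternGL E (Pi.mulSingle (placeAboveTwo F E k) ε *
        Pi.mulSingle (⟨c⁻¹ • (placeAboveTwo F E k).1, isReal_smul_iff.mpr (placeAboveTwo F E k).2⟩ :
          {w : InfinitePlace E // w.IsReal}) ε)))
      (by rintro q ⟨k, rfl⟩; exact hP _)
      (fun k => mA (signPatternGL E (Pi.mulSingle (placeAboveTwo F E k) ε))) (fun k => hP _)
      (by rintro i q ⟨k, rfl⟩; exact hs₀ i k) hs₁ hs₁' hgen ?_).elim fun exs h => ⟨_, h.2⟩
    · -- the prescribed origin value at the pair representatives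
      rintro q ⟨k, rfl⟩ Φ
      beta_reduce
      refine hval_of_originValue_one F E c hcδ hδ hd e (Matrix.diagonal dV) hV hVd (Matrix.diagonal dW) hW hWd
        (UnitaryGroup.archToAdelic F E c (n + n) (hermD F E e (Matrix.diagonal dV) (Matrix.diagonal dW)))
        (frame3D F E c hcδ hδ e dV hdV0 dW hdW0) (archWeilSection3D F E c hcδ hδ e dV hdV0 dW hdW0 x₂ x₃)
        (archWeilHalf3D_hfin F E c hcδ hδ hd e dV hV dW hW)
        (archWeilHalf3D_hdict F E c hcδ hδ hd e dV hV hVd hdV0 dW hW hWd hdW0 x₂ hx₂ x₃ hx₃)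
        (archWeilHalf3D F E c hcδ hδ hd e dV hVd hdV0 dW hWd hdW0 x₂ hx₂ x₃ hx₃)
        (archWeilHalf3D_eq_archLift F E c hcδ hδ hd e dV hV hVd hdV0 dW hW hWd hdW0 x₂ hx₂ x₃ hx₃)
        χ η₀ z hz' _ ?_ ?_ Φ
      · -- origin value `+1` (GR-2's `conj_archWeilSection3D_apply_zero_of_sign` at the pair coordinates)
        intro f
        rw [one_mul]
        refine conj_archWeilSection3D_apply_zero_of_sign F E c hcδ hδ e dV hVd hdV0 dW hWd hdW0 x₂ hx₂ x₃ _
          (fun w => map_evalC_leviCayley_pair F E c e dV dW (placeAboveTwo F E) eκ he₁ he₂ hcc hVd hWd mA h2 ε dε hεd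
            hdε k w)
          _ ?_ ?_
          (fun j => map_evalR_leviCayley_pair F E c e dV dW (placeAboveTwo F E) eκ he₁ he₂ hcc hVd hWd mA h2 ε dε hεd
            hdε k j) z hz f
        · intro j i
          cases h : (e₂ (n := n)).symm i with
          | inl a => simp only [Sum.elim_inl]; split_ifs; exacts [hdε1 a, Or.inl rfl]
          | inr a => simp only [Sum.elim_inr]; split_ifs; exacts [hdε1 a, Or.inl rfl]
        · intro j i
          simp only [Equiv.symm_apply_apply, Sum.elim_inl, Sum.elim_inr]
      · -- `η₀ (q₀ k) = χ(det_Δ (q₀ k)) |det_Δ (q₀ k)|^{1/2}` : all three are `1`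
        have hchi : chiDet F E c e (Matrix.diagonal dV) (Matrix.diagonal dW) χ
            (UnitaryGroup.archToAdelic F E c (n + n) (hermD F E e (Matrix.diagonal dV) (Matrix.diagonal dW))
              (mA (signPatternGL E (Pi.mulSingle (placeAboveTwo F E k) ε *
                Pi.mulSingle (⟨c⁻¹ • (placeAboveTwo F E k).1, isReal_smul_iff.mpr (placeAboveTwo F E k).2⟩ :
                  {w : InfinitePlace E // w.IsReal}) ε)))) = 1 :=
          chiDet_leviCayley_pair_eq_one F E c hcδ hδ e (Matrix.diagonal dV) (Matrix.diagonal dW) mA hP hΔ hc hχ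
            (placeAboveTwo F E) eκ he₁ he₂ ε k
        have hmod : modDelta F E c e (Matrix.diagonal dV) (Matrix.diagonal dW)
            (UnitaryGroup.archToAdelic F E c (n + n) (hermD F E e (Matrix.diagonal dV) (Matrix.diagonal dW))
              (mA (signPatternGL E (Pi.mulSingle (placeAboveTwo F E k) ε *
                Pi.mulSingle (⟨c⁻¹ • (placeAboveTwo F E k).1, isReal_smul_iff.mpr (placeAboveTwo F E k).2⟩ :
                  {w : InfinitePlace E // w.IsReal}) ε)))) = 1 :=
          modDelta_leviCayley_signPattern_eq_one F E c e (Matrix.diagonal dV) (Matrix.diagonal dW) mA hP hΔ _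
            (abs_det_mulSingle_mul_mulSingle_apply _ _ ε hεabs)
        have hval : ((η₀ (mA (signPatternGL E (Pi.mulSingle (placeAboveTwo F E k) ε *
            Pi.mulSingle (⟨c⁻¹ • (placeAboveTwo F E k).1, isReal_smul_iff.mpr (placeAboveTwo F E k).2⟩ :
              {w : InfinitePlace E // w.IsReal}) ε))) : ℂˣ) : ℂ) = 1 := by
          rw [hη₀]
          exact archTwist_pair_eq_one F E c e dV dW hVd hWd mA h2 (placeAboveTwo F E) eκ he₁ he₂ ε dε hεd hdε hcc hc χ
            (placeAboveOne F E) (smul_placeAboveOne F E c) (fun k => (ex k + 1) / 2) η₁ hη₁ (placeAboveComplex F E) k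
        rw [hval]
        symm
        calc _ = (1 : ℂ) * 1 := congrArg₂ (· * ·) (Units.val_eq_one.mpr hchi) (by exact_mod_cast hmod)
          _ = 1 := one_mul 1

set_option maxHeartbeats 800000 in
include hV hW hdV0 hdW0 in
/-- **Corollary: an archimedean half exists** at diagonal Gram data, for every quadratic `E/F` (real places of
`E` allowed), every unitary `χ` with `χ|_{𝕀_F} = ε_{E/F}`, given the enumeration `eκ` of the real places of `E`.
[cite: GelbartRogawski1991, §3.1 Prop. 3.1.1 p. 455] -/
theorem exists_isArchHalf_real {χ : HeckeCharacter E} (hχu : χ.IsUnitary)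
    (hχ : IsSplittingCharExt F E 1 χ)
    (eκ : {v : {v : InfinitePlace F // v.IsReal} // ¬ IsTypeOne F E v} ⊕
        {v : {v : InfinitePlace F // v.IsReal} // ¬ IsTypeOne F E v} ≃ {w : InfinitePlace E // w.IsReal})
    (he₁ : ∀ k, eκ (Sum.inl k) = placeAboveTwo F E k)
    (he₂ : ∀ k, eκ (Sum.inr k) =
      ⟨c⁻¹ • (placeAboveTwo F E k).1, isReal_smul_iff.mpr (placeAboveTwo F E k).2⟩) :
    ∃ sa : arch F E c (n + n) (hermD F E e (Matrix.diagonal dV) (Matrix.diagonal dW)) →*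
        MpD F e (Matrix.diagonal dV) (Matrix.diagonal dW),
      IsArchHalf F E c hcδ hδ hd e (Matrix.diagonal dV) hV hVd (Matrix.diagonal dW) hW hWd χ sa := by
  obtain ⟨⟨x₂, hx₂⟩, x₃, hx₃⟩ := exists_archWeilHalf3D_lifts F E e dV hdV0 dW hdW0 (hδ := hδ)
  obtain ⟨η, hη⟩ := exists_isArchHalf_twist_archWeilHalf3D_real F E c hcδ hδ hd e dV hV hVd hdV0 dW hW hWd hdW0
    x₂ hx₂ x₃ hx₃ hχu hχ eκ he₁ he₂
  exact ⟨_, hη⟩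

end Literature.NumberTheory.GelbartRogawski1991.GRConstructionGen

end
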